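import Summits.CriticalPhenomena.CardyFormulaZ2.Theses.CardySelfRefinement

/-!
# Route CardySelfRefinement — `Assembly` (item stmt-CriticalPhenomena-17655)

Pure logic: the thirteen items of route `CardySelfRefinement` (rev 15) compose to `CardyFormulaZ2`.
`RussoDrift` turns the three engine cruxes (`TrivialSectorRate`, `CriticalPathRSW`,
`GradientComparability`) into the lattice lags; `ExactEndpoints` + `LagsToInvariance` give
`S₂`- and `S₃`-invariance of every subsequential quad-crossing limit; `TwoLagsAllLags` gives
`ScaleInvariantLimits`; `LagHandOff` (fed with `RotationInput` and `ScaleInvariantLimits`) gives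
eventual measurability of the interfaces and, along every sequence of meshes, a subsequence and one
local Markov chordal family `P` tracing no boundary arc which is the limit of the interfaces along
that subsequence; `SymmetryUpgradeR` (the repaired symmetry upgrade, clause (iv) load-bearing)
identifies `P D` as the chordal SLE₆ law in every Dobrushin domain `D` that admits an admissible
ℤ²-discretisation family, and `DiscretisationFamilyExists` (the shared, proved construction) says
that EVERY Dobrushin domain admits one — so `P D` is chordal SLE₆ for every `D`, with no
Rohde–Schramm patch; `SubseqUpgrade` upgrades to SLE₆ convergence for all admissible
discretisations; `InterfaceToCardy` concludes `CardyFormulaZ2`.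

History: this file first proved the rev-2 assembly (stmt-CriticalPhenomena-10287, chained through
the as-typed `SymmetryUpgrade`, refuted-misstated 2026-08-16 by `Theorems.not_SymmetryUpgrade`),
then the rev-12 restatement through `SymmetryUpgradeR` (stmt-CriticalPhenomena-17240, whose proof
patched the non-discretised domains with `Literature.…exists_isSLELaw_of_ne_eight`, reached through a
Theses import dropped at rev 15). The route decl `Assembly` was restated once more (rev 15) with the
extra hypothesis `DiscretisationFamilyExists` as item stmt-CriticalPhenomena-17655, and the theorem
below (same name) now proves that decl — the chain of the rev-15 deciding theorem `closes` verbatim.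

References: Beffara 2008 (arXiv:0708.3908) §5; Duminil-Copin–Kozlowski–Krachun–Manolescu–Oulamara
2020 (arXiv:2012.11672); Smirnov 2001.
-/

namespace Summit.CriticalPhenomena.CardyFormulaZ2.Theorems

open Summit.CriticalPhenomena.CardyFormulaZ2.Theses.CardySelfRefinement

/-- The assembly item of route `CardySelfRefinement` (stmt-CriticalPhenomena-17655, the rev-15
restatement of stmt-CriticalPhenomena-17240 with the proved shared construction
`DiscretisationFamilyExists` in place of the Rohde–Schramm SLE₆-existence patch): the route's
thirteen items imply `CardyFormulaZ2`, by pure composition (the same plumbing as the route's deciding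
theorem `closes`, rev 15): `ScaleInvariantLimits` is DERIVED from the engine
(`RussoDrift`, `ExactEndpoints`, `LagsToInvariance`, `TwoLagsAllLags`); the subsequential interface
limit `P` given by `LagHandOff` is chordal SLE₆ on every admissibly discretised Dobrushin domain by
`SymmetryUpgradeR`, hence on every Dobrushin domain by `DiscretisationFamilyExists`; then
`SubseqUpgrade` and `InterfaceToCardy` are applied. -/
theorem cardySelfRefinement_assembly_proof :
    Summit.CriticalPhenomena.CardyFormulaZ2.Theses.CardySelfRefinement.Assembly := by
  unfold Assembly
  intro hTSR hCPR hGC hLH hSUR hRot hITC hRD hEE hLTI hTLA hSU hDFE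
  -- the target X = ScaleInvariantLimits, derived from the self-refinement engine
  have hSIL : ScaleInvariantLimits := hTLA (hLTI hEE (hRD hTSR hCPR hGC))
  -- the hand-off: eventual measurability and, along every mesh sequence, one subsequential family
  obtain ⟨hmeas, hseq⟩ := hLH hRot hSIL
  refine hITC (hSU ⟨hmeas, fun δs hpos hlim => ?_⟩)
  obtain ⟨φ, hφ, P, hP, hnt, hconv⟩ := hseq δs hpos hlim
  -- the repaired symmetry upgrade: `P D` is chordal SLE₆ wherever `D` is admissibly discretised …
  have hsle : ∀ (D : Literature.Probability.RandomPlanarGeometry.DobrushinDomain)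
      (E : ℝ → Literature.Probability.LatticeModels.DiscreteDobrushin),
      Literature.Probability.LatticeModels.ZdDiscretisationFamily D E →
        Literature.Probability.RandomPlanarGeometry.IsSLELaw 6 D (P D) :=
    hSUR P hP hnt hmeas
      ⟨fun n => δs (φ n), fun n => hpos (φ n), hlim.comp hφ.tendsto_atTop, hconv⟩
  -- … and every Dobrushin domain is admissibly discretised (`DiscretisationFamilyExists`)
  refine ⟨φ, hφ, P, fun D => ?_, hconv⟩
  obtain ⟨Λ, h₁, h₂, h₃, h₄, h₅, h₆⟩ := hDFE D
  exact hsle D Λ ⟨h₁, h₂, h₃, h₄, h₅, h₆⟩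

end Summit.CriticalPhenomena.CardyFormulaZ2.Theorems
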